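import Literature.Geometry.Kaehler.ComplexTorusSiegelReduction
import Literature.AlgebraicGeometry.Motives.ComplexTorusAlgebraicGroupLaw
import Summits.HodgeConjecture.CorCM.Geometry.PolarisedTorusAlgebraic
import HarnessLib

/-!
# COR-CM geometry: a complex torus with a Riemann form is an abelian variety (assembly)

Cell `pub-hodgecm2` (COR-CM), LIT-FANOUT row D2 — «complex tori with a Riemann form are projective»
(Huybrechts, *Complex Geometry*, Cor. 5.3.5 (⇐); Lange–Birkenhake, *Complex Abelian Varieties*,
§4.1 with Thm. 4.5.1 (Lefschetz) and Thm. 4.2.1; Mumford, *Abelian Varieties*, §3 Corollary) ON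
THE TREE'S CARRIER `Literature.Geometry.Kaehler.ComplexTorus Φ` / `ComplexTorus.IsAbelianVariety Φ`
(`ComplexTorusSubvarieties.lean`). ASSEMBLY of four landed bricks:

* `ComplexTorus.IsRiemannForm.exists_symplecticBasis_typeD` (`ComplexTorusFrobeniusBasis.lean`,
  Frobenius' symplectic basis of type `D`, Lange–Birkenhake §3.1) and
  `ComplexTorus.IsAbelianVariety.exists_siegelTorus` (`ComplexTorusSiegelReduction.lean`, Siegel
  normal form Prop. 8.1.1 and the base-change biholomorphism): the polarised torus is biholomorphic,
  by an additive homeomorphism, to a Siegel torus `ℂ^g/(Dℤ^g ⊕ Ωℤ^g)`, along which analytifications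
  transport;
* `Summit.HodgeConjecture.CorCM.exists_smoothProjective_of_siegel_typeD`
  (`PolarisedTorusAlgebraic.lean`: theta functions of level three and type `D`, Chow's theorem, the
  `RiemannWeightOne` algebraisation): the Siegel torus is the analytification of a smooth projective
  `g`-fold;
* `Literature.AlgebraicGeometry.Motives.exists_abelianVariety_of_complexTorus_isAnalytification`
  (`ComplexTorusAlgebraicGroupLaw.lean`, GAGA for maps): a smooth projective variety analytified by
  a complex torus is an abelian variety whose group law is the torus's.

Results: `exists_smoothProjective_of_isAbelianVariety` (Huybrechts 5.3.5 ⇐) and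
`exists_abelianVariety_of_isAbelianVariety` («a complex torus admitting a Riemann form is an abelian
variety»). Everything here is a theorem; no definition, no named fact.

## References

* [LangeBirkenhake1992] H. Lange, Ch. Birkenhake, *Complex Abelian Varieties* (1992), §3.1, §4.1,
  Thm. 4.2.1, Thm. 4.5.1, §8.1 Prop. 8.1.1.
* [HuybrechtsComplexGeometry2005] D. Huybrechts, *Complex Geometry* (2005), Cor. 5.3.5.
* [MumfordAV1970] D. Mumford, *Abelian Varieties* (1970), §3 (Theorem of Lefschetz, Corollary).
-/

noncomputable section

open scoped Manifold ContDiff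
open Module
open Literature.Geometry.Kaehler
open Literature.NumberTheory.Transcendental (IsAnalytification)
open Literature.AlgebraicGeometry.Motives (SchemeOver ComplexPoints IsSmoothProjective AbelianVariety
  exists_abelianVariety_of_complexTorus_isAnalytification)

namespace Summit.HodgeConjecture.CorCM.PolarisedTorus

variable {ι : Type} [Fintype ι] [DecidableEq ι] {E : Type} [NormedAddCommGroup E] [NormedSpace ℂ E]
  [FiniteDimensional ℂ E]

/-- **A polarised complex torus is the analytification of a smooth projective variety** (Huybrechts
Cor. 5.3.5 (⇐); Lange–Birkenhake §4.1, Thm. 4.5.1): if `X = E/Φ(ℤ^ι)` admits a Riemann form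
(`ComplexTorus.IsAbelianVariety Φ`), there are a smooth projective `ℂ`-scheme `Y` of dimension
`dim_ℂ E` and an analytification `φ : X → Y(ℂ)`. Proof: `X` is biholomorphic to a Siegel torus of
type `D` (`IsAbelianVariety.exists_siegelTorus`), which is analytified by a smooth projective variety
(`exists_smoothProjective_of_siegel_typeD`); transport along the biholomorphism.
[cite: LangeBirkenhake1992, §4.1 and Thm. 4.5.1] [cite: HuybrechtsComplexGeometry2005, Cor. 5.3.5] -/
theorem exists_smoothProjective_of_isAbelianVariety (Φ : (ι → ℝ) ≃L[ℝ] E)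
    (hX : ComplexTorus.IsAbelianVariety Φ) :
    ∃ (Y : SchemeOver ℂ) (φ : ComplexTorus Φ → ComplexPoints Y),
      IsSmoothProjective (finrank ℂ E) Y ∧ IsAnalytification E Y (finrank ℂ E) φ := by
  obtain ⟨g, d, Ω, Φ', e, hd, -, hΩsym, hΩpos, hΦ'v, -, -, -, -, hdim, htransport⟩ :=
    hX.exists_siegelTorus
  obtain ⟨N, F, Y, ιY, _, _, ψ, -, -, hψ, -, hY⟩ :=
    exists_smoothProjective_of_siegel_typeD Ω hΩsym hΩpos d hd Φ' hΦ'v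
  refine ⟨Y, ψ ∘ e, ?_, ?_⟩
  · rw [hdim]; exact hY
  · rw [hdim]; exact htransport Y ψ hψ

/-- **A complex torus admitting a Riemann form is an abelian variety** (Lange–Birkenhake §4.1
«an abelian variety is by definition a complex torus admitting a polarization» reconciled with the
scheme-theoretic definition `Motives.AbelianVariety`, via Thm. 4.2.1 / Mumford §3: the torus is
projective, and its group law is algebraic by GAGA): if `X = E/Φ(ℤ^ι)` admits a Riemann form, there
are an abelian variety `A/ℂ` of dimension `dim_ℂ E` and an analytification `φ : X → A(ℂ)` of its
underlying smooth projective variety which is a GROUP ISOMORPHISM onto the complex points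
(`φ(x + y) = φ(x)·φ(y)`, `φ(0) = 1`, `φ(-x) = φ(x)⁻¹`).
[cite: LangeBirkenhake1992, §4.1 and Thm. 4.2.1] [cite: MumfordAV1970, §3 Corollary] -/
theorem exists_abelianVariety_of_isAbelianVariety (Φ : (ι → ℝ) ≃L[ℝ] E)
    (hX : ComplexTorus.IsAbelianVariety Φ) :
    ∃ (A : AbelianVariety ℂ) (φ : ComplexTorus Φ → ComplexPoints A.X),
      A.dim = finrank ℂ E ∧ IsAnalytification E A.X (finrank ℂ E) φ ∧
      IsSmoothProjective (finrank ℂ E) A.X ∧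
      (∀ x y : ComplexTorus Φ, φ (x + y) = φ x * φ y) ∧ φ 0 = 1 ∧
      ∀ x : ComplexTorus Φ, φ (-x) = (φ x)⁻¹ := by
  obtain ⟨Y, ψ, hY, hψ⟩ := exists_smoothProjective_of_isAbelianVariety Φ hX
  obtain ⟨A, φ, -, hdim, hφ, hA, hadd, hzero, hneg⟩ :=
    exists_abelianVariety_of_complexTorus_isAnalytification hY hψ
  exact ⟨A, φ, hdim, hφ, hA, hadd, hzero, hneg⟩

end Summit.HodgeConjecture.CorCM.PolarisedTorus

end
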